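import Summits.Parity.GeneralizedHardyLittlewood.Theorems.PrimeLevelFamEdgeMomentsBeyondDiagonalFirstOrderTwistedMomentK
import HarnessLib

/-!
# The mollified first moment of `Λ^{(k)}(f,½)` at prime level: reduction to the explicit diagonal sum
# (helper for crux K_A `PrimeLevelFamEdge.MomentsBeyondDiagonal`, stmt-Parity-20007, stub `stub_first : SubFirst` ∀`Q`)

For `N` prime, a real profile `P` with `|P| ≤ B` on `[0,1]`, a mollifier length `1 < M ≤ N` and every order `k`:
`‖Σʰ_f Λ^{(k)}(f,½) M_P(f) − q̂^{1/2} Σ_{m ≤ M} x_m m^{−1/2} ∫_{2π/N²}^∞ e^{−x}(log(q̂/m)+log x)^k dx‖ ≤ C_k (1 + log N)^{k+4} q̂^{1/2} B M / N`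
(`x_m = KMV2000.mollifierCoeff P M m`; `harmonicSum_derivLambda_mul_mollifierP_sub_le`) — the order-`k` twisted moment
(`harmonicSum_heckeLambda_mul_derivLambda_sub_le`) summed against `|x_m| ≤ B m^{−1/2}` (`KMV2000.abs_mollifierCoeff_le`). For
`M = q̂^{Δ'}`, `Δ' < 2`, the right side is `≪ q̂^{1/2} · q̂^{Δ'−2}(log)^{k+4} = o(q̂^{1/2}(log q̂)^{−A})`: beyond the diagonal up to
`Δ' < 2` the mollified first moment at every order is its DIAGONAL up to a power saving (what remains for `stub_first` ∀`Q` is the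
real-variable asymptotic of the diagonal sum, KMV §4.1 (19)–(20) at order `k`). Proof only; nothing about Landau–Siegel zeros;
K_A NOT proved.
-/

noncomputable section

open scoped Real
open Complex Set MeasureTheory Filter Topology Finset CongruenceSubgroup Polynomial
open Literature.NumberTheory.EllipticCurves.ModularForms
open Literature.NumberTheory.LFunctions Literature.NumberTheory.LFunctions.KMV2000

namespace Summit.Parity.GeneralizedHardyLittlewood.Theorems.MomentsBeyondDiagonal.FirstOrderAFE

variable {N : ℕ} [NeZero N]

/-- `Σʰ Λ^{(k)}(f,½) M_P(f) = Σ_{m ≤ M} x_m Σʰ λ_f(m) Λ^{(k)}(f,½)` (finite sums). [cite: KowalskiMichelVanderKam2000, (9), §4 (16)] -/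
theorem harmonicSum_derivLambda_mul_mollifierP_eq_sum (P : ℝ[X]) (M : ℝ) (k : ℕ) :
    GL2Family.harmonicSum N 2 (fun f ↦ derivLambda N k f * mollifierP N P M f) =
      ∑ m ∈ Finset.Icc 1 ⌊M⌋₊, (mollifierCoeff P M m : ℂ) *
        GL2Family.harmonicSum N 2 (fun f ↦ GL2Family.heckeLambda f m * derivLambda N k f) := by
  have hfin := finite_newforms0_holds N 2
  unfold GL2Family.harmonicSum
  simp_rw [mollifierP_eq_sum_mollifierCoeff, Finset.mul_sum, finsum_mem_eq_finite_toFinset_sum _ hfin, Finset.mul_sum]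
  rw [Finset.sum_comm]
  exact Finset.sum_congr rfl fun m _ ↦ Finset.sum_congr rfl fun f _ ↦ by ring

/-- **The mollified first moment at order `k` is its diagonal up to `≪_k (1 + log N)^{k+4} q̂^{1/2} B M/N`** (`N` prime,
`|P| ≤ B` on `[0,1]`, `1 < M ≤ N`). [cite: Bettin2017, Thm. 1.1] [cite: KowalskiMichelVanderKam2000, §4 (16), Prop. 4.1] -/
theorem harmonicSum_derivLambda_mul_mollifierP_sub_le (k : ℕ) :
    ∃ C : ℝ, 0 ≤ C ∧ ∀ (N : ℕ) [NeZero N], N.Prime → ∀ (P : ℝ[X]) (B : ℝ),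
      (∀ t ∈ Set.Icc (0 : ℝ) 1, |P.eval t| ≤ B) → ∀ M : ℝ, 1 < M → M ≤ N →
      ‖GL2Family.harmonicSum N 2 (fun f ↦ derivLambda N k f * mollifierP N P M f) -
          ((KMV2000.qhat N : ℝ) : ℂ) ^ (1 / 2 : ℂ) * ∑ m ∈ Finset.Icc 1 ⌊M⌋₊, (mollifierCoeff P M m : ℂ) *
            (((m : ℝ) ^ (-(1 / 2 : ℝ)) : ℝ) : ℂ) *
            ((∫ x in Ioi (2 * π / (N : ℝ) ^ 2), Real.exp (-x) * (Real.log (KMV2000.qhat N / m) + Real.log x) ^ k : ℝ) : ℂ)‖ ≤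
        C * (1 + Real.log N) ^ (k + 4) * Real.sqrt (KMV2000.qhat N) * B * M / N := by
  obtain ⟨C, hC0, hC⟩ := harmonicSum_heckeLambda_mul_derivLambda_sub_le k
  refine ⟨C, hC0, fun N _ hN P B hB M hM1 hMN ↦ ?_⟩
  have hN0 : (0 : ℝ) < N := by exact_mod_cast hN.pos
  have hM0 : 0 ≤ M := by linarith
  have hB0 : 0 ≤ B := (abs_nonneg _).trans (hB 0 ⟨le_rfl, zero_le_one⟩)
  have hL0 : 0 ≤ Real.log N := Real.log_nonneg (by exact_mod_cast hN.one_lt.le)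
  set E : ℝ := C * (1 + Real.log N) ^ (k + 4) * Real.sqrt (KMV2000.qhat N) with hE
  have hE0 : 0 ≤ E := by positivity
  rw [harmonicSum_derivLambda_mul_mollifierP_eq_sum, Finset.mul_sum, ← Finset.sum_sub_distrib]
  have hterm : ∀ m ∈ Finset.Icc 1 ⌊M⌋₊,
      ‖(mollifierCoeff P M m : ℂ) * GL2Family.harmonicSum N 2 (fun f ↦ GL2Family.heckeLambda f m * derivLambda N k f) -
          ((KMV2000.qhat N : ℝ) : ℂ) ^ (1 / 2 : ℂ) * ((mollifierCoeff P M m : ℂ) * (((m : ℝ) ^ (-(1 / 2 : ℝ)) : ℝ) : ℂ) *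
            ((∫ x in Ioi (2 * π / (N : ℝ) ^ 2), Real.exp (-x) *
              (Real.log (KMV2000.qhat N / m) + Real.log x) ^ k : ℝ) : ℂ))‖ ≤ B * (E / N) := by
    intro m hm
    have hm1 : 1 ≤ m := (Finset.mem_Icc.1 hm).1
    have hmM : m ≤ ⌊M⌋₊ := (Finset.mem_Icc.1 hm).2
    have hm0 : (0 : ℝ) < m := by exact_mod_cast hm1
    have hmN : m ≤ N := by
      have h : (m : ℝ) ≤ N := ((Nat.cast_le.mpr hmM).trans (Nat.floor_le hM0)).trans hMN
      exact_mod_cast h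
    have hx := KMV2000.abs_mollifierCoeff_le hB hM1 hm
    have hS := hC N hN m hm1 hmN
    rw [show (mollifierCoeff P M m : ℂ) * GL2Family.harmonicSum N 2 (fun f ↦ GL2Family.heckeLambda f m * derivLambda N k f) -
        ((KMV2000.qhat N : ℝ) : ℂ) ^ (1 / 2 : ℂ) * ((mollifierCoeff P M m : ℂ) * (((m : ℝ) ^ (-(1 / 2 : ℝ)) : ℝ) : ℂ) *
          ((∫ x in Ioi (2 * π / (N : ℝ) ^ 2), Real.exp (-x) * (Real.log (KMV2000.qhat N / m) + Real.log x) ^ k : ℝ) : ℂ)) =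
        (mollifierCoeff P M m : ℂ) * (GL2Family.harmonicSum N 2 (fun f ↦ GL2Family.heckeLambda f m * derivLambda N k f) -
          ((KMV2000.qhat N : ℝ) : ℂ) ^ (1 / 2 : ℂ) * (((m : ℝ) ^ (-(1 / 2 : ℝ)) : ℝ) : ℂ) *
            ((∫ x in Ioi (2 * π / (N : ℝ) ^ 2), Real.exp (-x) *
              (Real.log (KMV2000.qhat N / m) + Real.log x) ^ k : ℝ) : ℂ)) by ring, norm_mul, Complex.norm_real,
      Real.norm_eq_abs]
    unfold mollifierCoeff at *
    have hone : (m : ℝ) ^ (-(1 / 2 : ℝ)) * Real.sqrt m = 1 := by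
      rw [Real.sqrt_eq_rpow, ← Real.rpow_add hm0]; norm_num
    calc |(ArithmeticFunction.moebius m : ℝ) * ((psi m)⁻¹ * (m : ℝ) ^ (-(1 / 2 : ℝ)) * P.eval (Real.log (M / m) / Real.log M))| *
          ‖GL2Family.harmonicSum N 2 (fun f ↦ GL2Family.heckeLambda f m * derivLambda N k f) -
            ((KMV2000.qhat N : ℝ) : ℂ) ^ (1 / 2 : ℂ) * (((m : ℝ) ^ (-(1 / 2 : ℝ)) : ℝ) : ℂ) *
              ((∫ x in Ioi (2 * π / (N : ℝ) ^ 2), Real.exp (-x) *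
                (Real.log (KMV2000.qhat N / m) + Real.log x) ^ k : ℝ) : ℂ)‖
        ≤ (B * (m : ℝ) ^ (-(1 / 2 : ℝ))) * (C * (1 + Real.log N) ^ (k + 4) * Real.sqrt (KMV2000.qhat N) * Real.sqrt m / N) :=
          mul_le_mul hx hS (norm_nonneg _) (by positivity)
      _ = B * (E / N) * ((m : ℝ) ^ (-(1 / 2 : ℝ)) * Real.sqrt m) := by rw [hE]; ring
      _ = B * (E / N) := by rw [hone, mul_one]
  have hcard : ((Finset.Icc 1 ⌊M⌋₊).card : ℝ) ≤ M := by
    rw [Nat.card_Icc, Nat.add_sub_cancel]; exact Nat.floor_le hM0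
  calc ‖∑ m ∈ Finset.Icc 1 ⌊M⌋₊, ((mollifierCoeff P M m : ℂ) *
          GL2Family.harmonicSum N 2 (fun f ↦ GL2Family.heckeLambda f m * derivLambda N k f) -
          ((KMV2000.qhat N : ℝ) : ℂ) ^ (1 / 2 : ℂ) * ((mollifierCoeff P M m : ℂ) * (((m : ℝ) ^ (-(1 / 2 : ℝ)) : ℝ) : ℂ) *
            ((∫ x in Ioi (2 * π / (N : ℝ) ^ 2), Real.exp (-x) *
              (Real.log (KMV2000.qhat N / m) + Real.log x) ^ k : ℝ) : ℂ)))‖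
      ≤ ∑ m ∈ Finset.Icc 1 ⌊M⌋₊, B * (E / N) := (norm_sum_le _ _).trans (Finset.sum_le_sum hterm)
    _ = ((Finset.Icc 1 ⌊M⌋₊).card : ℝ) * (B * (E / N)) := by rw [Finset.sum_const, nsmul_eq_mul]
    _ ≤ M * (B * (E / N)) := mul_le_mul_of_nonneg_right hcard (by positivity)
    _ = C * (1 + Real.log N) ^ (k + 4) * Real.sqrt (KMV2000.qhat N) * B * M / N := by rw [hE]; ring

/-! ## Completing the diagonal integral: `∫_{2π/N²}^∞ → ∫_0^∞` -/

/-- **Completion of the lower limit**: for every `k` there is `C_k` with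
`|∫_δ^∞ e^{−x}(log c + log x)^k dx − ∫_0^∞ e^{−x}(log c + log x)^k dx| ≤ C_k (1 + |log c|)^k √δ` for all `c > 0`, `δ > 0`
(`1 ≤ √δ x^{−1/2}` on `(0, δ]`, `x^{−1/2}e^{−x}|log x|^j ∈ L¹`). -/
theorem abs_integral_Ioi_expLogPow_sub_le (k : ℕ) :
    ∃ C : ℝ, 0 ≤ C ∧ ∀ c : ℝ, 0 < c → ∀ δ : ℝ, 0 < δ →
      |(∫ x in Ioi δ, Real.exp (-x) * (Real.log c + Real.log x) ^ k) -
          ∫ x in Ioi 0, Real.exp (-x) * (Real.log c + Real.log x) ^ k| ≤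
        C * (1 + |Real.log c|) ^ k * Real.sqrt δ := by
  -- the two absolute constants
  have hK : ∀ j : ℕ, IntegrableOn (fun x : ℝ ↦ x ^ (-(1 / 2 : ℝ)) * (Real.exp (-x) * |Real.log x| ^ j)) (Ioi 0) := by
    intro j
    have h := integrableOn_rpow_mul_expLogPow one_pos j (σ := -(1 / 2 : ℝ)) (by norm_num)
    simpa only [Real.log_one, zero_add] using h
  set K : ℕ → ℝ := fun j ↦ ∫ x in Ioi (0 : ℝ), x ^ (-(1 / 2 : ℝ)) * (Real.exp (-x) * |Real.log x| ^ j) with hKdef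
  have hK0 : ∀ j, 0 ≤ K j := fun j ↦ setIntegral_nonneg measurableSet_Ioi fun x hx ↦ by
    have hx : (0 : ℝ) < x := hx
    positivity
  refine ⟨2 ^ k * (K 0 + K k), by have := hK0 0; have := hK0 k; positivity, fun c hc δ hδ ↦ ?_⟩
  have hint := integrableOn_expLogPow hc k
  -- the difference is the integral over `(0, δ]`
  have hdiff : (∫ x in Ioi δ, Real.exp (-x) * (Real.log c + Real.log x) ^ k) -
      ∫ x in Ioi 0, Real.exp (-x) * (Real.log c + Real.log x) ^ k =
      -∫ x in Ioc 0 δ, Real.exp (-x) * (Real.log c + Real.log x) ^ k := by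
    have h := intervalIntegral.integral_Ioi_sub_Ioi hint hδ.le
    rw [intervalIntegral.integral_of_le hδ.le] at h
    linarith
  rw [hdiff, abs_neg]
  -- pointwise majorant on `(0, δ]`
  set L : ℝ := |Real.log c| with hL
  set g : ℝ → ℝ := fun x ↦ Real.sqrt δ * 2 ^ k *
    (L ^ k * (x ^ (-(1 / 2 : ℝ)) * (Real.exp (-x) * |Real.log x| ^ 0)) +
      x ^ (-(1 / 2 : ℝ)) * (Real.exp (-x) * |Real.log x| ^ k)) with hg
  have hg_int : IntegrableOn g (Ioi 0) := (((hK 0).const_mul (L ^ k)).add (hK k)).const_mul _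
  have hg_nonneg : ∀ x ∈ Ioi (0 : ℝ), 0 ≤ g x := fun x hx ↦ by
    have hx : (0 : ℝ) < x := hx
    positivity
  have hptw : ∀ x ∈ Ioc (0 : ℝ) δ, ‖Real.exp (-x) * (Real.log c + Real.log x) ^ k‖ ≤ g x := by
    intro x hx
    have hx0 : 0 < x := hx.1
    have hxδ : x ≤ δ := hx.2
    -- `1 ≤ √δ · x^{-1/2}`
    have hone : 1 ≤ Real.sqrt δ * x ^ (-(1 / 2 : ℝ)) := by
      rw [Real.rpow_neg hx0.le, ← Real.sqrt_eq_rpow, ← div_eq_mul_inv, le_div_iff₀ (Real.sqrt_pos.mpr hx0), one_mul]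
      exact Real.sqrt_le_sqrt hxδ
    -- `|log c + log x|^k ≤ 2^k (L^k + |log x|^k)`
    have hadd : |Real.log c + Real.log x| ^ k ≤ 2 ^ k * (L ^ k + |Real.log x| ^ k) := by
      have h1 : |Real.log c + Real.log x| ≤ L + |Real.log x| := abs_add_le _ _
      have h2 : L + |Real.log x| ≤ 2 * max L |Real.log x| := by
        rcases le_total L |Real.log x| with h | h
        · rw [max_eq_right h]; linarith
        · rw [max_eq_left h]; linarith
      refine (pow_le_pow_left₀ (abs_nonneg _) (h1.trans h2) k).trans ?_
      rw [mul_pow]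
      gcongr
      rcases le_total L |Real.log x| with h | h
      · rw [max_eq_right h]; linarith [pow_nonneg (abs_nonneg (Real.log c)) k]
      · rw [max_eq_left h]; linarith [pow_nonneg (abs_nonneg (Real.log x)) k]
    rw [norm_mul, Real.norm_of_nonneg (Real.exp_pos _).le, norm_pow, Real.norm_eq_abs]
    calc Real.exp (-x) * |Real.log c + Real.log x| ^ k
        ≤ Real.exp (-x) * (2 ^ k * (L ^ k + |Real.log x| ^ k)) * 1 := by
          rw [mul_one]; exact mul_le_mul_of_nonneg_left hadd (Real.exp_pos _).le
      _ ≤ Real.exp (-x) * (2 ^ k * (L ^ k + |Real.log x| ^ k)) * (Real.sqrt δ * x ^ (-(1 / 2 : ℝ))) := by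
          gcongr
      _ = g x := by rw [hg]; simp only [pow_zero, mul_one]; ring
  have hmaj : ‖∫ x in Ioc 0 δ, Real.exp (-x) * (Real.log c + Real.log x) ^ k‖ ≤ ∫ x in Ioc 0 δ, g x :=
    norm_integral_le_of_norm_le (hg_int.mono_set Ioc_subset_Ioi_self)
      ((ae_restrict_iff' measurableSet_Ioc).mpr (Filter.Eventually.of_forall hptw))
  rw [Real.norm_eq_abs] at hmaj
  refine hmaj.trans ((setIntegral_mono_set hg_int ((ae_restrict_iff' measurableSet_Ioi).mpr
    (Filter.Eventually.of_forall hg_nonneg)) (Filter.Eventually.of_forall Ioc_subset_Ioi_self)).trans ?_)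
  -- the value of the majorant integral
  have hval : ∫ x in Ioi 0, g x = Real.sqrt δ * 2 ^ k * (L ^ k * K 0 + K k) := by
    rw [hg, integral_const_mul, integral_add ((hK 0).const_mul _) (hK k), integral_const_mul]
  rw [hval]
  have hL0 : 0 ≤ L := abs_nonneg _
  have h1 : L ^ k * K 0 + K k ≤ (K 0 + K k) * (1 + L) ^ k := by
    have hLk : L ^ k ≤ (1 + L) ^ k := pow_le_pow_left₀ hL0 (by linarith) k
    have h1k : (1 : ℝ) ≤ (1 + L) ^ k := one_le_pow₀ (by linarith)
    nlinarith [hK0 0, hK0 k, mul_le_mul_of_nonneg_right hLk (hK0 0)]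
  calc Real.sqrt δ * 2 ^ k * (L ^ k * K 0 + K k) ≤ Real.sqrt δ * 2 ^ k * ((K 0 + K k) * (1 + L) ^ k) := by
        gcongr
    _ = 2 ^ k * (K 0 + K k) * (1 + L) ^ k * Real.sqrt δ := by ring

/-- **Order-`k` twisted first moment with the COMPLETE diagonal integral** `𝒱_k(q̂/m) = ∫_0^∞ e^{−x}(log(q̂/m)+log x)^k dx`
(`= Σ_i (k choose i) Γ^{(k−i)}(1) log^i(q̂/m)`): for `N` prime, `1 ≤ m ≤ N`,
`‖Σʰλ_f(m)Λ^{(k)}(f,½) − q̂^{1/2} m^{−1/2} 𝒱_k(q̂/m)‖ ≤ C_k (1 + log N)^{k+4} q̂^{1/2} √m/N`. [cite: Bettin2017, Thm. 1.1]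
[cite: KowalskiMichelVanderKam2000, §4 (16), (19)–(20)] -/
theorem harmonicSum_heckeLambda_mul_derivLambda_sub_complete_le (k : ℕ) :
    ∃ C : ℝ, 0 ≤ C ∧ ∀ (N : ℕ) [NeZero N], N.Prime → ∀ m : ℕ, 1 ≤ m → m ≤ N →
      ‖GL2Family.harmonicSum N 2 (fun f ↦ GL2Family.heckeLambda f m * derivLambda N k f) -
          ((KMV2000.qhat N : ℝ) : ℂ) ^ (1 / 2 : ℂ) * (((m : ℝ) ^ (-(1 / 2 : ℝ)) : ℝ) : ℂ) *
            ((∫ x in Ioi 0, Real.exp (-x) * (Real.log (KMV2000.qhat N / m) + Real.log x) ^ k : ℝ) : ℂ)‖ ≤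
        C * (1 + Real.log N) ^ (k + 4) * Real.sqrt (KMV2000.qhat N) * Real.sqrt m / N := by
  obtain ⟨C₁, hC₁0, h₁⟩ := harmonicSum_heckeLambda_mul_derivLambda_sub_le k
  obtain ⟨C₂, hC₂0, h₂⟩ := abs_integral_Ioi_expLogPow_sub_le k
  refine ⟨C₁ + C₂ * 4 ^ k * Real.sqrt (2 * π), by positivity, fun N _ hN m hm hmN ↦ ?_⟩
  have hN2 : (2 : ℝ) ≤ N := by exact_mod_cast hN.two_le
  have hN0 : (0 : ℝ) < N := by linarith
  have hm1 : (1 : ℝ) ≤ m := by exact_mod_cast hm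
  have hm0 : (0 : ℝ) < m := by linarith
  have hmN' : (m : ℝ) ≤ N := by exact_mod_cast hmN
  have hq := qhat_pos_of_neZero N
  set L : ℝ := Real.log N with hLdef
  have hL0 : 0 < L := Real.log_pos (by linarith)
  have hδ : 0 < 2 * π / (N : ℝ) ^ 2 := by positivity
  have hc : 0 < KMV2000.qhat N / m := div_pos hq hm0
  have hI := h₂ _ hc _ hδ
  have hS := h₁ N hN m hm hmN
  -- `|log(q̂/m)| ≤ 2 L` (`q̂ ≤ N`, `m ≤ N`), `√δ = √(2π)/N`, `m^{-1/2} ≤ √m`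
  have hqN : KMV2000.qhat N ≤ N := by
    unfold KMV2000.qhat
    rw [div_le_iff₀ (by positivity)]
    have hs : Real.sqrt N ≤ N := by rw [Real.sqrt_le_left hN0.le]; nlinarith
    nlinarith [Real.pi_gt_three, Real.sqrt_nonneg (N : ℝ)]
  have hlogc : |Real.log (KMV2000.qhat N / m)| ≤ 4 * L := by
    rw [Real.log_div hq.ne' hm0.ne', abs_le]
    have h1 : Real.log (KMV2000.qhat N) ≤ L := Real.log_le_log hq hqN
    have h2 : Real.log m ≤ L := Real.log_le_log hm0 hmN'
    have h3 : 0 ≤ Real.log m := Real.log_nonneg hm1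
    -- `q̂ = √N/(2π) ≥ N⁻³` (`N^{7/2} ≥ 2π`), so `log q̂ ≥ −3L`
    have h4 : -(3 * L) ≤ Real.log (KMV2000.qhat N) := by
      have hs1 : 1 ≤ Real.sqrt N := by rw [← Real.sqrt_one]; exact Real.sqrt_le_sqrt (by linarith)
      have hq1 : ((N : ℝ) ^ 3)⁻¹ ≤ KMV2000.qhat N := by
        unfold KMV2000.qhat
        rw [inv_le_iff_one_le_mul₀ (by positivity), div_eq_mul_inv]
        have hN8 : (8 : ℝ) ≤ (N : ℝ) ^ 3 := by nlinarith
        have hπ : 1 / 8 ≤ (2 * π)⁻¹ := by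
          rw [one_div, inv_le_inv₀ (by positivity) (by positivity)]; linarith [Real.pi_lt_four]
        calc (1 : ℝ) = 1 * (1 / 8) * 8 := by norm_num
          _ ≤ Real.sqrt N * (2 * π)⁻¹ * (N : ℝ) ^ 3 := by gcongr
      have := Real.log_le_log (by positivity) hq1
      rw [Real.log_inv, Real.log_pow] at this
      push_cast at this
      linarith
    constructor <;> linarith
  have hsqδ : Real.sqrt (2 * π / (N : ℝ) ^ 2) = Real.sqrt (2 * π) / N := by
    rw [Real.sqrt_div (by positivity), Real.sqrt_sq hN0.le]
  have hmm : (m : ℝ) ^ (-(1 / 2 : ℝ)) ≤ Real.sqrt m := by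
    have h1 : (m : ℝ) ^ (-(1 / 2 : ℝ)) ≤ 1 := Real.rpow_le_one_of_one_le_of_nonpos hm1 (by norm_num)
    exact h1.trans (by rw [← Real.sqrt_one]; exact Real.sqrt_le_sqrt hm1)
  have h1L : (1 : ℝ) ≤ 1 + L := by linarith
  have hpow : (1 + |Real.log (KMV2000.qhat N / m)|) ^ k ≤ 4 ^ k * (1 + L) ^ k := by
    rw [← mul_pow]; exact pow_le_pow_left₀ (by positivity) (by linarith) k
  have hpow' : (1 + L) ^ k ≤ (1 + L) ^ (k + 4) := pow_le_pow_right₀ h1L (by omega)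
  -- the norm of the completed correction
  have hnq : ‖((KMV2000.qhat N : ℝ) : ℂ) ^ (1 / 2 : ℂ)‖ = Real.sqrt (KMV2000.qhat N) := by
    rw [Complex.norm_cpow_eq_rpow_re_of_pos hq, Real.sqrt_eq_rpow]; norm_num
  have hcorr : ‖((KMV2000.qhat N : ℝ) : ℂ) ^ (1 / 2 : ℂ) * (((m : ℝ) ^ (-(1 / 2 : ℝ)) : ℝ) : ℂ) *
      (((∫ x in Ioi (2 * π / (N : ℝ) ^ 2), Real.exp (-x) * (Real.log (KMV2000.qhat N / m) + Real.log x) ^ k : ℝ) : ℂ) -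
        ((∫ x in Ioi 0, Real.exp (-x) * (Real.log (KMV2000.qhat N / m) + Real.log x) ^ k : ℝ) : ℂ))‖ ≤
      C₂ * 4 ^ k * Real.sqrt (2 * π) * ((1 + L) ^ (k + 4) * Real.sqrt (KMV2000.qhat N) * Real.sqrt m / N) := by
    rw [norm_mul, norm_mul, hnq, Complex.norm_real, Real.norm_of_nonneg (Real.rpow_nonneg hm0.le _), ← Complex.ofReal_sub,
      Complex.norm_real, Real.norm_eq_abs]
    calc Real.sqrt (KMV2000.qhat N) * (m : ℝ) ^ (-(1 / 2 : ℝ)) *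
          |(∫ x in Ioi (2 * π / (N : ℝ) ^ 2), Real.exp (-x) * (Real.log (KMV2000.qhat N / m) + Real.log x) ^ k) -
            ∫ x in Ioi 0, Real.exp (-x) * (Real.log (KMV2000.qhat N / m) + Real.log x) ^ k|
        ≤ Real.sqrt (KMV2000.qhat N) * Real.sqrt m *
            (C₂ * (1 + |Real.log (KMV2000.qhat N / m)|) ^ k * Real.sqrt (2 * π / (N : ℝ) ^ 2)) := by gcongr
      _ ≤ Real.sqrt (KMV2000.qhat N) * Real.sqrt m * (C₂ * (4 ^ k * (1 + L) ^ (k + 4)) * Real.sqrt (2 * π / (N : ℝ) ^ 2)) := by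
          gcongr
          exact hpow.trans (by gcongr)
      _ = C₂ * 4 ^ k * Real.sqrt (2 * π) * ((1 + L) ^ (k + 4) * Real.sqrt (KMV2000.qhat N) * Real.sqrt m / N) := by
          rw [hsqδ]; ring
  calc _ = ‖(GL2Family.harmonicSum N 2 (fun f ↦ GL2Family.heckeLambda f m * derivLambda N k f) -
          ((KMV2000.qhat N : ℝ) : ℂ) ^ (1 / 2 : ℂ) * (((m : ℝ) ^ (-(1 / 2 : ℝ)) : ℝ) : ℂ) *
            ((∫ x in Ioi (2 * π / (N : ℝ) ^ 2), Real.exp (-x) * (Real.log (KMV2000.qhat N / m) + Real.log x) ^ k : ℝ) : ℂ)) +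
        ((KMV2000.qhat N : ℝ) : ℂ) ^ (1 / 2 : ℂ) * (((m : ℝ) ^ (-(1 / 2 : ℝ)) : ℝ) : ℂ) *
          (((∫ x in Ioi (2 * π / (N : ℝ) ^ 2), Real.exp (-x) * (Real.log (KMV2000.qhat N / m) + Real.log x) ^ k : ℝ) : ℂ) -
            ((∫ x in Ioi 0, Real.exp (-x) * (Real.log (KMV2000.qhat N / m) + Real.log x) ^ k : ℝ) : ℂ))‖ := by
        ring_nf
    _ ≤ C₁ * (1 + L) ^ (k + 4) * Real.sqrt (KMV2000.qhat N) * Real.sqrt m / N +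
          C₂ * 4 ^ k * Real.sqrt (2 * π) * ((1 + L) ^ (k + 4) * Real.sqrt (KMV2000.qhat N) * Real.sqrt m / N) :=
        (norm_add_le _ _).trans (add_le_add hS hcorr)
    _ = (C₁ + C₂ * 4 ^ k * Real.sqrt (2 * π)) * (1 + L) ^ (k + 4) * Real.sqrt (KMV2000.qhat N) * Real.sqrt m / N := by ring

/-- **The mollified first moment at order `k` against the COMPLETE diagonal weight `𝒱_k`** (`N` prime, `|P| ≤ B` on `[0,1]`,
`1 < M ≤ N`): `‖Σʰ Λ^{(k)} M_P − q̂^{1/2} Σ_{m ≤ M} x_m m^{−1/2} 𝒱_k(log(q̂/m))‖ ≤ C_k (1 + log N)^{k+4} q̂^{1/2} B M/N`,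
`𝒱_k(L) = ∫_0^∞ e^{−x}(L + log x)^k dx`. [cite: Bettin2017, Thm. 1.1] [cite: KowalskiMichelVanderKam2000, §4 (16), (19)–(20)] -/
theorem harmonicSum_derivLambda_mul_mollifierP_sub_complete_le (k : ℕ) :
    ∃ C : ℝ, 0 ≤ C ∧ ∀ (N : ℕ) [NeZero N], N.Prime → ∀ (P : ℝ[X]) (B : ℝ),
      (∀ t ∈ Set.Icc (0 : ℝ) 1, |P.eval t| ≤ B) → ∀ M : ℝ, 1 < M → M ≤ N →
      ‖GL2Family.harmonicSum N 2 (fun f ↦ derivLambda N k f * mollifierP N P M f) -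
          ((KMV2000.qhat N : ℝ) : ℂ) ^ (1 / 2 : ℂ) * ∑ m ∈ Finset.Icc 1 ⌊M⌋₊, (mollifierCoeff P M m : ℂ) *
            (((m : ℝ) ^ (-(1 / 2 : ℝ)) : ℝ) : ℂ) *
            ((∫ x in Ioi 0, Real.exp (-x) * (Real.log (KMV2000.qhat N / m) + Real.log x) ^ k : ℝ) : ℂ)‖ ≤
        C * (1 + Real.log N) ^ (k + 4) * Real.sqrt (KMV2000.qhat N) * B * M / N := by
  obtain ⟨C, hC0, hC⟩ := harmonicSum_heckeLambda_mul_derivLambda_sub_complete_le k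
  refine ⟨C, hC0, fun N _ hN P B hB M hM1 hMN ↦ ?_⟩
  have hN0 : (0 : ℝ) < N := by exact_mod_cast hN.pos
  have hM0 : 0 ≤ M := by linarith
  have hB0 : 0 ≤ B := (abs_nonneg _).trans (hB 0 ⟨le_rfl, zero_le_one⟩)
  have hL0 : 0 ≤ Real.log N := Real.log_nonneg (by exact_mod_cast hN.one_lt.le)
  set E : ℝ := C * (1 + Real.log N) ^ (k + 4) * Real.sqrt (KMV2000.qhat N) with hE
  have hE0 : 0 ≤ E := by positivity
  rw [harmonicSum_derivLambda_mul_mollifierP_eq_sum, Finset.mul_sum, ← Finset.sum_sub_distrib]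
  have hterm : ∀ m ∈ Finset.Icc 1 ⌊M⌋₊,
      ‖(mollifierCoeff P M m : ℂ) * GL2Family.harmonicSum N 2 (fun f ↦ GL2Family.heckeLambda f m * derivLambda N k f) -
          ((KMV2000.qhat N : ℝ) : ℂ) ^ (1 / 2 : ℂ) * ((mollifierCoeff P M m : ℂ) * (((m : ℝ) ^ (-(1 / 2 : ℝ)) : ℝ) : ℂ) *
            ((∫ x in Ioi 0, Real.exp (-x) *
              (Real.log (KMV2000.qhat N / m) + Real.log x) ^ k : ℝ) : ℂ))‖ ≤ B * (E / N) := by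
    intro m hm
    have hm1 : 1 ≤ m := (Finset.mem_Icc.1 hm).1
    have hmM : m ≤ ⌊M⌋₊ := (Finset.mem_Icc.1 hm).2
    have hm0 : (0 : ℝ) < m := by exact_mod_cast hm1
    have hmN : m ≤ N := by
      have h : (m : ℝ) ≤ N := ((Nat.cast_le.mpr hmM).trans (Nat.floor_le hM0)).trans hMN
      exact_mod_cast h
    have hx := KMV2000.abs_mollifierCoeff_le hB hM1 hm
    have hS := hC N hN m hm1 hmN
    rw [show (mollifierCoeff P M m : ℂ) * GL2Family.harmonicSum N 2 (fun f ↦ GL2Family.heckeLambda f m * derivLambda N k f) -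
        ((KMV2000.qhat N : ℝ) : ℂ) ^ (1 / 2 : ℂ) * ((mollifierCoeff P M m : ℂ) * (((m : ℝ) ^ (-(1 / 2 : ℝ)) : ℝ) : ℂ) *
          ((∫ x in Ioi 0, Real.exp (-x) * (Real.log (KMV2000.qhat N / m) + Real.log x) ^ k : ℝ) : ℂ)) =
        (mollifierCoeff P M m : ℂ) * (GL2Family.harmonicSum N 2 (fun f ↦ GL2Family.heckeLambda f m * derivLambda N k f) -
          ((KMV2000.qhat N : ℝ) : ℂ) ^ (1 / 2 : ℂ) * (((m : ℝ) ^ (-(1 / 2 : ℝ)) : ℝ) : ℂ) *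
            ((∫ x in Ioi 0, Real.exp (-x) *
              (Real.log (KMV2000.qhat N / m) + Real.log x) ^ k : ℝ) : ℂ)) by ring, norm_mul, Complex.norm_real,
      Real.norm_eq_abs]
    unfold mollifierCoeff at *
    have hone : (m : ℝ) ^ (-(1 / 2 : ℝ)) * Real.sqrt m = 1 := by
      rw [Real.sqrt_eq_rpow, ← Real.rpow_add hm0]; norm_num
    calc |(ArithmeticFunction.moebius m : ℝ) * ((psi m)⁻¹ * (m : ℝ) ^ (-(1 / 2 : ℝ)) * P.eval (Real.log (M / m) / Real.log M))| *
          ‖GL2Family.harmonicSum N 2 (fun f ↦ GL2Family.heckeLambda f m * derivLambda N k f) -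
            ((KMV2000.qhat N : ℝ) : ℂ) ^ (1 / 2 : ℂ) * (((m : ℝ) ^ (-(1 / 2 : ℝ)) : ℝ) : ℂ) *
              ((∫ x in Ioi 0, Real.exp (-x) *
                (Real.log (KMV2000.qhat N / m) + Real.log x) ^ k : ℝ) : ℂ)‖
        ≤ (B * (m : ℝ) ^ (-(1 / 2 : ℝ))) * (C * (1 + Real.log N) ^ (k + 4) * Real.sqrt (KMV2000.qhat N) * Real.sqrt m / N) :=
          mul_le_mul hx hS (norm_nonneg _) (by positivity)
      _ = B * (E / N) * ((m : ℝ) ^ (-(1 / 2 : ℝ)) * Real.sqrt m) := by rw [hE]; ring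
      _ = B * (E / N) := by rw [hone, mul_one]
  have hcard : ((Finset.Icc 1 ⌊M⌋₊).card : ℝ) ≤ M := by
    rw [Nat.card_Icc, Nat.add_sub_cancel]; exact Nat.floor_le hM0
  calc ‖∑ m ∈ Finset.Icc 1 ⌊M⌋₊, ((mollifierCoeff P M m : ℂ) *
          GL2Family.harmonicSum N 2 (fun f ↦ GL2Family.heckeLambda f m * derivLambda N k f) -
          ((KMV2000.qhat N : ℝ) : ℂ) ^ (1 / 2 : ℂ) * ((mollifierCoeff P M m : ℂ) * (((m : ℝ) ^ (-(1 / 2 : ℝ)) : ℝ) : ℂ) *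
            ((∫ x in Ioi 0, Real.exp (-x) *
              (Real.log (KMV2000.qhat N / m) + Real.log x) ^ k : ℝ) : ℂ)))‖
      ≤ ∑ m ∈ Finset.Icc 1 ⌊M⌋₊, B * (E / N) := (norm_sum_le _ _).trans (Finset.sum_le_sum hterm)
    _ = ((Finset.Icc 1 ⌊M⌋₊).card : ℝ) * (B * (E / N)) := by rw [Finset.sum_const, nsmul_eq_mul]
    _ ≤ M * (B * (E / N)) := mul_le_mul_of_nonneg_right hcard (by positivity)
    _ = C * (1 + Real.log N) ^ (k + 4) * Real.sqrt (KMV2000.qhat N) * B * M / N := by rw [hE]; ring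

end Summit.Parity.GeneralizedHardyLittlewood.Theorems.MomentsBeyondDiagonal.FirstOrderAFE

end
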